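import Literature.AlgebraicGeometry.Frobenioids.PadicFrobenioidPrimMulTransport
import Literature.AlgebraicGeometry.Frobenioids.PadicFrobenioidBadLocalKit
import HarnessLib

/-!
# Frobenioids II, Example 1.1 (ii): the MONOGENIC datum `(ℤ_{≥0}·ord(c), B^c)` of a constant section `c` is FUNCTORIAL in MULTIPLICATIVE
# valuative isomorphisms of the base field functor carrying `c₁` to an associate of `c₂` (the `c`-NORMALISED transport); specialisation: the
# bad-place datum `C⊢_v` of `Φ = ℕ·log(q̲_v)` ([IUTchI] Ex 3.2 (iv))

S. Mochizuki, *The geometry of Frobenioids II*, Kyushu J. Math. **62** (2008) 401–460, §1, Example 1.1 (ii) pp. 8–9 (the `p`-adic Frobenioid of a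
monoid `Φ ⊆ Φ₀|_D` with `B := B₀|_D ×_{Φ₀^gp} Φ^gp`; the fibre product at `Λ = ℤ` is OUR paraphrase, as in abc-iut-L1's `PadicFrobenioidMonogenic`)
[cite: MochizukiFrdII2008, Ex 1.1 (ii) p.8]; *The geometry of Frobenioids I*, Prop. 5.3 p. 103 (morphisms of model data induce functors), Cor. 5.4
p. 104 [cite: MochizukiFrdI2008, Prop. 5.3 p.103].  Consumed by [IUTchI] Ex 3.2 (iv) p. 71 (`𝒞⊢_v`, «a `p_v`-adic Frobenioid with base category given
by `𝒟⊢_v`», `Φ_{𝒞⊢_v} := ℕ·log_Φ(q̲_v)|_{𝒟⊢_v}`) and Cor 5.3 (iii) p. 144 («the natural map `Isom(¹𝔉⊢, ²𝔉⊢) → Isom(¹𝔇⊢, ²𝔇⊢)` [cf. Remark 5.2.1, (i)]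
is surjective»).

WHAT THIS FILE BUILDS (abc-iut cell; L1-level brick for L5 row R80 «COR53III-BAD-SLOT» (a); generic, no IUT vocabulary; the `Φ^c`-twin of
abc-iut-L5-t16's `PadicFrobenioidPrimMulTransport` (p517458) — by abc-iut-L1's `Datum.monogenic_p_eq_prim` that file is the sibling at `c = p`; no
claim of subsumption either way).  `Datum.monogenic F hcs` reads ONLY `𝒪^×_{K_A}` and the constant section `c`; hence for base functors `F₁, F₂`
with constant sections `c₁, c₂`, a natural integral MULTIPLICATIVE family `τ_A : (F₁ A).K^× → (F₂ A).K^×` carrying `c₁(A)` to an ASSOCIATE of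
`c₂(A)` (`hτc`: `v(τ_A c₁(A)) = v(c₂(A))`, DISPLAYED; `τ_A c₁(A) ≠ c₂(A)` allowed) induces the `c`-NORMALISED morphism of monogenic data over the
SAME base: §1 `monoΦTransport` (generator to generator; = `(ord τ_A) ⊗ ℝ` restricted, `subtype_monoΦTransport`); §2 `monoCorr` (`n·ord(c₁) ↦
(ĉ₂/τ_A ĉ₁)^n`, divisor `0`), `monoMulTransportβ` = “`τ_A` on `𝒪^×`, `ĉ₁ ↦ ĉ₂`” (OUR normalisation; `monoMulTransportβ_liftGen`: **`ĉ₁ ↦ ĉ₂`** on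
abc-iut-L1 `Monogenic.liftGen`, which determines the characteristic splitting); §3 `monoMulTransport : ModelFrobenioid.DataHom (Datum.monogenic F₁
hcs₁ …).divB (Datum.monogenic F₂ hcs₂ …).divB` (`comm` is `rfl`), `η` bijective; §4 bijective `β` from an inverse family `τ'` ([FrdI] Cor 5.4's input
for abc-iut-w5-d137's `DataHomOver.functor_isEquivalence`); §5 the specialisation `badDatumMulTransport` at abc-iut-L1-t4's `BadLocalKit.datum E …
hq'` (`c := E.img q̲`), `…β_liftGen`, `…β_bijective`.  Binders `τ`, `hτ`, `hnat`, `hτc` displayed; NO rigidity clause (print's Cor 5.3 (iii) asserts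
surjectivity); 0 instance · 0 notation · no `Prop` fact; p517458's §0 helpers consumed BY NAME.  Classical plumbing over landed L1 files; nothing
here concerns [IUTchIII] Cor. 3.12; no side is taken on any disputed claim.
-/

noncomputable section

namespace Literature.AlgebraicGeometry.Frobenioids

open CategoryTheory Opposite Function
open scoped ValuativeRel

namespace PadicFrd

universe u v
/-! ### §1. The component on the divisor monoids: generator to generator -/

section Transport

variable {D : Type u} [Category.{v} D] {p : ℕ} [Fact p.Prime] (F₁ F₂ : D ⥤ PadicFld.{u} p) (c₁ : ∀ A : D, intNonzero (F₁.obj A).K) (c₂ : ∀ A : D, intNonzero (F₂.obj A).K)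
  (hcs₁ : Monogenic.IsConstantSection F₁ c₁) (hcs₂ : Monogenic.IsConstantSection F₂ c₂)
  (hloc₁ : ∀ A : D, (F₁.obj A).IsPadicLocal) (hloc₂ : ∀ A : D, (F₂.obj A).IsPadicLocal)
  (hc : IsConnected D) (he : IsTotallyEpimorphic D)
  (τ : ∀ A : D, (F₁.obj A).Kˣ →* (F₂.obj A).Kˣ)
  (hτ : ∀ (A : D) (x : (F₁.obj A).Kˣ),
    ValuativeRel.valuation (F₁.obj A).K (x : (F₁.obj A).K) ≤ 1 → ValuativeRel.valuation (F₂.obj A).K (τ A x : (F₂.obj A).K) ≤ 1)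
  (hnat : ∀ {A A' : D} (f : A' ⟶ A) (x : (F₁.obj A).Kˣ),
    τ A' (Units.map ((F₁.map f).alg : (F₁.obj A).K →* (F₁.obj A').K) x) =
      Units.map ((F₂.map f).alg : (F₂.obj A).K →* (F₂.obj A').K) (τ A x))
  (hτc : ∀ A : D,
    ValuativeRel.valuation (F₂.obj A).K ((τ A (intNonzeroToUnits (F₁.obj A).K (c₁ A)) : (F₂.obj A).Kˣ) : (F₂.obj A).K) =
      ValuativeRel.valuation (F₂.obj A).K ((c₂ A : ↥(intNonzero (F₂.obj A).K)) : (F₂.obj A).K))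

/-- **The component `η_A : Φ^{c₁}(A) ⥲ Φ^{c₂}(A)`**: `ord(c₁)^n ⊗ 1 ↦ ord(c₂)^n ⊗ 1` (both monoids are free on their generator,
abc-iut-L1 `Monogenic.gen_pow_injective`; composite of the two exponent isomorphisms). [cite: MochizukiFrdII2008, Ex 1.1 (ii) p.8] -/
def monoΦTransport (A : D) : ↥(Submonoid.powers (Monogenic.gen F₁ c₁ A)) ≃* ↥(Submonoid.powers (Monogenic.gen F₂ c₂ A)) := by
  classical
  exact (Submonoid.powLogEquiv (Monogenic.gen_pow_injective F₁ hcs₁ (hloc₁ A))).symm.trans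
    (Submonoid.powLogEquiv (Monogenic.gen_pow_injective F₂ hcs₂ (hloc₂ A)))

/-- The value of `η_A` on `ord(c₁)^n ⊗ 1`. [cite: MochizukiFrdII2008, Ex 1.1 (ii) p.8] -/
theorem monoΦTransport_pow (A : D) (n : ℕ) :
    monoΦTransport F₁ F₂ c₁ c₂ hcs₁ hcs₂ hloc₁ hloc₂ A ⟨Monogenic.gen F₁ c₁ A ^ n, n, rfl⟩ = ⟨Monogenic.gen F₂ c₂ A ^ n, n, rfl⟩ := by
  classical
  have e₁ : (⟨Monogenic.gen F₁ c₁ A ^ n, n, rfl⟩ : ↥(Submonoid.powers (Monogenic.gen F₁ c₁ A))) =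
      Submonoid.pow (Monogenic.gen F₁ c₁ A) n := rfl
  rw [monoΦTransport, e₁, MulEquiv.trans_apply, Submonoid.powLogEquiv_symm_apply,
    Submonoid.log_pow_eq_self (Monogenic.gen_pow_injective F₁ hcs₁ (hloc₁ A)), Submonoid.powLogEquiv_apply, toAdd_ofAdd]
  rfl

/-- The value of `η_A` read in `Φ₀(A)`: `ord(c₁)^n ⊗ 1 ↦ ord(c₂)^n ⊗ 1`. [cite: MochizukiFrdII2008, Ex 1.1 (ii) p.8] -/
theorem coe_monoΦTransport (A : D) (x : ↥(Submonoid.powers (Monogenic.gen F₁ c₁ A))) (n : ℕ)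
    (hx : (x : Realification (OrdInt (F₁.obj A).K)) = Monogenic.gen F₁ c₁ A ^ n) :
    ((monoΦTransport F₁ F₂ c₁ c₂ hcs₁ hcs₂ hloc₁ hloc₂ A x : ↥(Submonoid.powers (Monogenic.gen F₂ c₂ A))) :
        Realification (OrdInt (F₂.obj A).K)) = Monogenic.gen F₂ c₂ A ^ n := by
  have ex : x = ⟨Monogenic.gen F₁ c₁ A ^ n, n, rfl⟩ := Subtype.ext hx
  rw [ex, monoΦTransport_pow]

omit [Fact p.Prime] in include hτc in
/-- **`(ord τ_A ⊗ ℝ_{≥0})(ord(c₁) ⊗ 1) = ord(c₂) ⊗ 1`** (`τ_A c₁(A)` and `c₂(A)` have the same valuation, `hτc`). [cite: MochizukiFrdII2008, Ex 1.1 (ii) p.8] -/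
theorem realificationMap_gen (A : D) :
    Realification.map (ordIntMapOfUnits (τ A) (hτ A)) (Monogenic.gen F₁ c₁ A) = Monogenic.gen F₂ c₂ A := by
  rw [Monogenic.gen, Realification.map_of, ordIntMapOfUnits_mk, Monogenic.gen]
  congr 1
  apply associatesMk_eq_of_valuation_eq
  rw [coe_unitsIntMap]
  exact hτc A

include hτc in
/-- **`η_A` IS `(ord τ_A) ⊗ ℝ_{≥0}` restricted to `Φ^{c₁}`** (checked on the powers of the generator). [cite: MochizukiFrdII2008, Ex 1.1 (ii) p.8] -/
theorem subtype_monoΦTransport (A : D) (x : ↥(Submonoid.powers (Monogenic.gen F₁ c₁ A))) :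
    ((monoΦTransport F₁ F₂ c₁ c₂ hcs₁ hcs₂ hloc₁ hloc₂ A x : ↥(Submonoid.powers (Monogenic.gen F₂ c₂ A))) :
        Realification (OrdInt (F₂.obj A).K)) =
      Realification.map (ordIntMapOfUnits (τ A) (hτ A)) (x : Realification (OrdInt (F₁.obj A).K)) := by
  obtain ⟨y, n, rfl⟩ := x
  rw [coe_monoΦTransport F₁ F₂ c₁ c₂ hcs₁ hcs₂ hloc₁ hloc₂ A ⟨_, n, rfl⟩ n rfl, map_pow,
    realificationMap_gen F₁ F₂ c₁ c₂ τ hτ hτc]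

/-- **`η` is natural** for the pull-back maps of `Φ^c` (both fix the generator). [cite: MochizukiFrdII2008, Ex 1.1 (ii) p.8] -/
theorem monoΦTransport_natural {A A' : Dᵒᵖ} (g : A ⟶ A') (x : ↥(Submonoid.powers (Monogenic.gen F₁ c₁ A.unop))) :
    monoΦTransport F₁ F₂ c₁ c₂ hcs₁ hcs₂ hloc₁ hloc₂ A'.unop (Monogenic.ΦMap F₁ hcs₁ g x) =
      Monogenic.ΦMap F₂ hcs₂ g (monoΦTransport F₁ F₂ c₁ c₂ hcs₁ hcs₂ hloc₁ hloc₂ A.unop x) := by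
  obtain ⟨y, n, rfl⟩ := x
  apply Subtype.ext
  have h1 : ((Monogenic.ΦMap F₁ hcs₁ g ⟨Monogenic.gen F₁ c₁ A.unop ^ n, n, rfl⟩ :
      ↥(Submonoid.powers (Monogenic.gen F₁ c₁ A'.unop))) : Realification (OrdInt (F₁.obj A'.unop).K)) =
        Monogenic.gen F₁ c₁ A'.unop ^ n := by
    rw [Monogenic.coe_ΦMap, map_pow, Monogenic.phi0Map_gen F₁ hcs₁]
  rw [coe_monoΦTransport F₁ F₂ c₁ c₂ hcs₁ hcs₂ hloc₁ hloc₂ A'.unop _ n h1, Monogenic.coe_ΦMap,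
    coe_monoΦTransport F₁ F₂ c₁ c₂ hcs₁ hcs₂ hloc₁ hloc₂ A.unop _ n rfl, map_pow, Monogenic.phi0Map_gen F₂ hcs₂]

/-! ### §2. The correcting unit on `c^ℤ` and the component on `B^c` -/

/-- **The correcting unit `κ_A := ĉ₂(A) · (τ_A ĉ₁(A))⁻¹ ∈ (F₂ A).K^×`** (`ĉ` = the section read in `K^×`). [cite: MochizukiFrdII2008, Ex 1.1 (ii) p.8] -/
def monoCorrUnit (A : D) : (F₂.obj A).Kˣ :=
  intNonzeroToUnits (F₂.obj A).K (c₂ A) * (τ A (intNonzeroToUnits (F₁.obj A).K (c₁ A)))⁻¹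

omit [Fact p.Prime] in include hτc in
/-- `v(κ_A) = 1`. [cite: MochizukiFrdII2008, Ex 1.1 (ii) p.8] -/
theorem valuation_monoCorrUnit (A : D) :
    ValuativeRel.valuation (F₂.obj A).K (monoCorrUnit F₁ F₂ c₁ c₂ τ A : (F₂.obj A).K) = 1 := by
  rw [monoCorrUnit, Units.val_mul, Units.val_inv_eq_inv_val, map_mul, map_inv₀, hτc A]
  exact mul_inv_cancel₀ ((Valuation.ne_zero_iff _).mpr (c₂ A).2.2)

/-- **`corr_A : Φ^{c₁}(A)^gp → (F₂ A).K^×`, `n · ord(c₁) ↦ κ_A^n`** (via the exponent and the groupification). [cite: MochizukiFrdII2008, Ex 1.1 (ii) p.8] -/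
def monoCorr (A : D) : Algebra.GrothendieckGroup ↥(Submonoid.powers (Monogenic.gen F₁ c₁ A)) →* (F₂.obj A).Kˣ := by
  classical
  exact Algebra.GrothendieckGroup.lift
    ((powersHom (F₂.obj A).Kˣ (monoCorrUnit F₁ F₂ c₁ c₂ τ A)).comp
      (Submonoid.powLogEquiv (Monogenic.gen_pow_injective F₁ hcs₁ (hloc₁ A))).symm.toMonoidHom)

/-- The value of `corr_A` on `n · ord(c₁)`: `κ_A^n`. [cite: MochizukiFrdII2008, Ex 1.1 (ii) p.8] -/
theorem monoCorr_of_pow (A : D) (n : ℕ) :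
    monoCorr F₁ F₂ c₁ c₂ hcs₁ hloc₁ τ A (Algebra.GrothendieckGroup.of ⟨Monogenic.gen F₁ c₁ A ^ n, n, rfl⟩) =
      monoCorrUnit F₁ F₂ c₁ c₂ τ A ^ n := by
  classical
  have e₁ : (⟨Monogenic.gen F₁ c₁ A ^ n, n, rfl⟩ : ↥(Submonoid.powers (Monogenic.gen F₁ c₁ A))) =
      Submonoid.pow (Monogenic.gen F₁ c₁ A) n := rfl
  have h := Algebra.GrothendieckGroup.lift.symm_apply_apply
    ((powersHom (F₂.obj A).Kˣ (monoCorrUnit F₁ F₂ c₁ c₂ τ A)).comp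
      (Submonoid.powLogEquiv (Monogenic.gen_pow_injective F₁ hcs₁ (hloc₁ A))).symm.toMonoidHom)
  rw [Algebra.GrothendieckGroup.lift_symm_apply] at h
  have h' := DFunLike.congr_fun h ⟨Monogenic.gen F₁ c₁ A ^ n, n, rfl⟩
  rw [MonoidHom.comp_apply] at h'
  rw [monoCorr, h', MonoidHom.comp_apply, MulEquiv.coe_toMonoidHom, e₁, Submonoid.powLogEquiv_symm_apply,
    Submonoid.log_pow_eq_self (Monogenic.gen_pow_injective F₁ hcs₁ (hloc₁ A)), powersHom_apply, toAdd_ofAdd]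

include hτc in
/-- **`corr_A` has divisor `0`**: `Div₀ ∘ corr_A = 1` (its values are powers of the unit `κ_A`). [cite: MochizukiFrdII2008, Ex 1.1 (ii) p.8] -/
theorem divZeroHom_monoCorr (A : D) (γ : Algebra.GrothendieckGroup ↥(Submonoid.powers (Monogenic.gen F₁ c₁ A))) :
    divZeroHom (F₂.obj A).K (monoCorr F₁ F₂ c₁ c₂ hcs₁ hloc₁ τ A γ) = 1 := by
  suffices h : (divZeroHom (F₂.obj A).K).comp (monoCorr F₁ F₂ c₁ c₂ hcs₁ hloc₁ τ A) = 1 from DFunLike.congr_fun h γ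
  refine MonGp.hom_ext fun a => ?_
  obtain ⟨y, n, rfl⟩ := a
  rw [MonoidHom.comp_apply, monoCorr_of_pow, map_pow, divZeroHom_eq_one_of_valuation_eq_one _
    (valuation_monoCorrUnit F₁ F₂ c₁ c₂ τ hτc A), one_pow, MonoidHom.one_apply]

omit [Fact p.Prime] in include hcs₁ hcs₂ hnat in
/-- **`κ` is natural** (the sections are constant, `IsConstantSection.units_map_eq`; `τ` is natural). [cite: MochizukiFrdII2008, Ex 1.1 (ii) p.8] -/
theorem units_map_monoCorrUnit {A A' : D} (f : A' ⟶ A) :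
    Units.map ((F₂.map f).alg : (F₂.obj A).K →* (F₂.obj A').K) (monoCorrUnit F₁ F₂ c₁ c₂ τ A) =
      monoCorrUnit F₁ F₂ c₁ c₂ τ A' := by
  rw [monoCorrUnit, monoCorrUnit, map_mul, map_inv, ← hnat f, hcs₁.units_map_eq F₁ f, hcs₂.units_map_eq F₂ f]

include hcs₂ hnat in
/-- **`corr` is natural**: `corr_{A'} ∘ Φ^{c₁}(f)^gp = B₀(f) ∘ corr_A`. [cite: MochizukiFrdII2008, Ex 1.1 (ii) p.8] -/
theorem monoCorr_natural {A A' : Dᵒᵖ} (g : A ⟶ A')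
    (γ : Algebra.GrothendieckGroup ↥(Submonoid.powers (Monogenic.gen F₁ c₁ A.unop))) :
    monoCorr F₁ F₂ c₁ c₂ hcs₁ hloc₁ τ A'.unop (MonGp.map (Monogenic.ΦMap F₁ hcs₁ g) γ) =
      Units.map ((F₂.map g.unop).alg : (F₂.obj A.unop).K →* (F₂.obj A'.unop).K) (monoCorr F₁ F₂ c₁ c₂ hcs₁ hloc₁ τ A.unop γ) := by
  suffices h : (monoCorr F₁ F₂ c₁ c₂ hcs₁ hloc₁ τ A'.unop).comp (MonGp.map (Monogenic.ΦMap F₁ hcs₁ g)) =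
      (Units.map ((F₂.map g.unop).alg : (F₂.obj A.unop).K →* (F₂.obj A'.unop).K)).comp
        (monoCorr F₁ F₂ c₁ c₂ hcs₁ hloc₁ τ A.unop) from
    DFunLike.congr_fun h γ
  refine MonGp.hom_ext fun a => ?_
  obtain ⟨y, n, rfl⟩ := a
  have h1 : Monogenic.ΦMap F₁ hcs₁ g ⟨Monogenic.gen F₁ c₁ A.unop ^ n, n, rfl⟩ = ⟨Monogenic.gen F₁ c₁ A'.unop ^ n, n, rfl⟩ :=
    Subtype.ext (by rw [Monogenic.coe_ΦMap, map_pow, Monogenic.phi0Map_gen F₁ hcs₁])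
  rw [MonoidHom.comp_apply, MonoidHom.comp_apply, MonGp.map_of, h1, monoCorr_of_pow, monoCorr_of_pow, map_pow,
    units_map_monoCorrUnit F₁ F₂ c₁ c₂ hcs₁ hcs₂ τ hnat]

include hτ hτc in
/-- The pair `(τ_A x · corr_A γ, η_A^gp γ)` lies in `B^{c₂}(A)` whenever `(x, γ) ∈ B^{c₁}(A)` (`divZeroHom_unitsHom`, `divZeroHom_monoCorr`,
`subtype_monoΦTransport`). [cite: MochizukiFrdII2008, Ex 1.1 (ii) p.8] -/
theorem monoMulTransportβ_mem (A : Dᵒᵖ) (x : (F₁.obj A.unop).Kˣ)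
    (γ : Algebra.GrothendieckGroup ↥(Submonoid.powers (Monogenic.gen F₁ c₁ A.unop)))
    (hq : divZeroHom (F₁.obj A.unop).K x = MonGp.map (Submonoid.subtype (Submonoid.powers (Monogenic.gen F₁ c₁ A.unop))) γ) :
    divZeroHom (F₂.obj A.unop).K (τ A.unop x * monoCorr F₁ F₂ c₁ c₂ hcs₁ hloc₁ τ A.unop γ) =
      MonGp.map (Submonoid.subtype (Submonoid.powers (Monogenic.gen F₂ c₂ A.unop)))
        (MonGp.map (monoΦTransport F₁ F₂ c₁ c₂ hcs₁ hcs₂ hloc₁ hloc₂ A.unop).toMonoidHom γ) := by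
  rw [map_mul, divZeroHom_monoCorr F₁ F₂ c₁ c₂ hcs₁ hloc₁ τ hτc, mul_one, divZeroHom_unitsHom (τ A.unop) (hτ A.unop), hq,
    ← MonoidHom.comp_apply, ← MonGp.map_comp, ← MonoidHom.comp_apply, ← MonGp.map_comp]
  congr 1
  refine congrArg MonGp.map (MonoidHom.ext fun y => ?_)
  rw [MonoidHom.comp_apply, MonoidHom.comp_apply, Submonoid.subtype_apply, Submonoid.subtype_apply, MulEquiv.coe_toMonoidHom,
    subtype_monoΦTransport F₁ F₂ c₁ c₂ hcs₁ hcs₂ hloc₁ hloc₂ τ hτ hτc]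

/-- **The component `β_A : B^{c₁}(A) → B^{c₂}(A)`**: `(x, γ) ↦ (τ_A x · corr_A γ, η_A^gp γ)` — on a pair `(u · ĉ₁^n, n·ord(c₁))` (`u` a unit)
this is `(τ_A(u) · ĉ₂^n, n·ord(c₂))`: **`τ_A` on `𝒪^×`, `ĉ₁ ↦ ĉ₂`** (OUR normalisation). [cite: MochizukiFrdII2008, Ex 1.1 (ii) p.8] -/
def monoMulTransportβ (A : Dᵒᵖ) : ↥(Monogenic.BSub F₁ hcs₁ A) →* ↥(Monogenic.BSub F₂ hcs₂ A) where
  toFun q := ⟨((τ A.unop q.1.1 * monoCorr F₁ F₂ c₁ c₂ hcs₁ hloc₁ τ A.unop q.1.2 : (F₂.obj A.unop).Kˣ),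
      MonGp.map (monoΦTransport F₁ F₂ c₁ c₂ hcs₁ hcs₂ hloc₁ hloc₂ A.unop).toMonoidHom q.1.2),
    monoMulTransportβ_mem F₁ F₂ c₁ c₂ hcs₁ hcs₂ hloc₁ hloc₂ τ hτ hτc A q.1.1 q.1.2
      ((Monogenic.mem_BSub_iff F₁ hcs₁ A q.1).mp q.2)⟩
  map_one' := Subtype.ext (Prod.ext
    ((congrArg₂ (· * ·) (map_one (τ A.unop)) (map_one (monoCorr F₁ F₂ c₁ c₂ hcs₁ hloc₁ τ A.unop))).trans (mul_one _))
    (map_one (MonGp.map (monoΦTransport F₁ F₂ c₁ c₂ hcs₁ hcs₂ hloc₁ hloc₂ A.unop).toMonoidHom)))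
  map_mul' q r := Subtype.ext (Prod.ext
    ((congrArg₂ (· * ·) (map_mul (τ A.unop) q.1.1 r.1.1)
      (map_mul (monoCorr F₁ F₂ c₁ c₂ hcs₁ hloc₁ τ A.unop) q.1.2 r.1.2)).trans (mul_mul_mul_comm _ _ _ _))
    (map_mul (MonGp.map (monoΦTransport F₁ F₂ c₁ c₂ hcs₁ hcs₂ hloc₁ hloc₂ A.unop).toMonoidHom) q.1.2 r.1.2))

/-- The value of `β_A`: first component `τ_A x · corr_A γ`. [cite: MochizukiFrdII2008, Ex 1.1 (ii) p.8] -/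
@[simp] theorem monoMulTransportβ_fst (A : Dᵒᵖ) (q : ↥(Monogenic.BSub F₁ hcs₁ A)) :
    ((monoMulTransportβ F₁ F₂ c₁ c₂ hcs₁ hcs₂ hloc₁ hloc₂ τ hτ hτc A q : ↥(Monogenic.BSub F₂ hcs₂ A)).1).1 =
      τ A.unop q.1.1 * monoCorr F₁ F₂ c₁ c₂ hcs₁ hloc₁ τ A.unop q.1.2 := rfl

/-- The value of `β_A`: second component `η_A^gp γ`. [cite: MochizukiFrdII2008, Ex 1.1 (ii) p.8] -/
@[simp] theorem monoMulTransportβ_snd (A : Dᵒᵖ) (q : ↥(Monogenic.BSub F₁ hcs₁ A)) :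
    ((monoMulTransportβ F₁ F₂ c₁ c₂ hcs₁ hcs₂ hloc₁ hloc₂ τ hτ hτc A q : ↥(Monogenic.BSub F₂ hcs₂ A)).1).2 =
      MonGp.map (monoΦTransport F₁ F₂ c₁ c₂ hcs₁ hcs₂ hloc₁ hloc₂ A.unop).toMonoidHom q.1.2 := rfl

/-- **`β_A(ĉ₁) = ĉ₂`**: the distinguished element `(c₁(A), ord(c₁(A)))` of `B^{c₁}(A)` (abc-iut-L1 `Monogenic.liftGen`, which determines the
characteristic splitting) goes to that of `B^{c₂}(A)` — `τ_A ĉ₁ · (ĉ₂ / τ_A ĉ₁) = ĉ₂`. [cite: MochizukiFrdII2008, Ex 1.1 (ii) p.8] -/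
theorem monoMulTransportβ_liftGen (A : Dᵒᵖ) :
    monoMulTransportβ F₁ F₂ c₁ c₂ hcs₁ hcs₂ hloc₁ hloc₂ τ hτ hτc A (Monogenic.liftGen F₁ hcs₁ A) = Monogenic.liftGen F₂ hcs₂ A := by
  have e : ∀ (F : D ⥤ PadicFld.{u} p) (cF : ∀ A : D, intNonzero (F.obj A).K),
      (⟨Monogenic.gen F cF A.unop, Submonoid.mem_powers _⟩ : ↥(Submonoid.powers (Monogenic.gen F cF A.unop))) =
        ⟨Monogenic.gen F cF A.unop ^ 1, 1, rfl⟩ :=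
    fun F cF => Subtype.ext (pow_one _).symm
  refine Subtype.ext (Prod.ext ?_ ?_)
  · rw [monoMulTransportβ_fst]
    change τ A.unop (intNonzeroToUnits (F₁.obj A.unop).K (c₁ A.unop)) *
        monoCorr F₁ F₂ c₁ c₂ hcs₁ hloc₁ τ A.unop
          (Algebra.GrothendieckGroup.of ⟨Monogenic.gen F₁ c₁ A.unop, Submonoid.mem_powers _⟩) =
      intNonzeroToUnits (F₂.obj A.unop).K (c₂ A.unop)
    rw [e F₁ c₁, monoCorr_of_pow, pow_one, monoCorrUnit, mul_comm, inv_mul_cancel_right]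
  · rw [monoMulTransportβ_snd]
    change MonGp.map (monoΦTransport F₁ F₂ c₁ c₂ hcs₁ hcs₂ hloc₁ hloc₂ A.unop).toMonoidHom
        (Algebra.GrothendieckGroup.of ⟨Monogenic.gen F₁ c₁ A.unop, Submonoid.mem_powers _⟩) =
      Algebra.GrothendieckGroup.of ⟨Monogenic.gen F₂ c₂ A.unop, Submonoid.mem_powers _⟩
    rw [MonGp.map_of, MulEquiv.coe_toMonoidHom, e F₁ c₁, monoΦTransport_pow, e F₂ c₂]

/-! ### §3. The morphism of monogenic data -/

/-- **THE `c`-NORMALISED MORPHISM OF MONOGENIC DATA `(Φ^{c₁}, B^{c₁}, Div) → (Φ^{c₂}, B^{c₂}, Div)` induced by `τ`** ([FrdI] Prop 5.3;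
[FrdII] Ex 1.1 (ii)): `η` = generator to generator, `β = (τ · corr, η^gp)`, `Div_B`-compatibility definitional. [cite: MochizukiFrdII2008, Ex 1.1 (ii) p.8] -/
def monoMulTransport :
    ModelFrobenioid.DataHom (Datum.monogenic F₁ hcs₁ hloc₁ hc he).divB (Datum.monogenic F₂ hcs₂ hloc₂ hc he).divB where
  η :=
    { app := fun A => CommMonCat.ofHom (monoΦTransport F₁ F₂ c₁ c₂ hcs₁ hcs₂ hloc₁ hloc₂ A.unop).toMonoidHom
      naturality := fun {A A'} g => by
        apply CommMonCat.hom_ext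
        refine MonoidHom.ext fun x => ?_
        change (monoΦTransport F₁ F₂ c₁ c₂ hcs₁ hcs₂ hloc₁ hloc₂ A'.unop) (Monogenic.ΦMap F₁ hcs₁ g x) =
          Monogenic.ΦMap F₂ hcs₂ g (monoΦTransport F₁ F₂ c₁ c₂ hcs₁ hcs₂ hloc₁ hloc₂ A.unop x)
        exact monoΦTransport_natural F₁ F₂ c₁ c₂ hcs₁ hcs₂ hloc₁ hloc₂ g x }
  β :=
    { app := fun A => CommMonCat.ofHom (monoMulTransportβ F₁ F₂ c₁ c₂ hcs₁ hcs₂ hloc₁ hloc₂ τ hτ hτc A)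
      naturality := fun {A A'} g => by
        apply CommMonCat.hom_ext
        refine MonoidHom.ext fun q => Subtype.ext (Prod.ext ?_ ?_)
        · change τ A'.unop (Units.map ((F₁.map g.unop).alg : (F₁.obj A.unop).K →* (F₁.obj A'.unop).K) q.1.1) *
              monoCorr F₁ F₂ c₁ c₂ hcs₁ hloc₁ τ A'.unop (MonGp.map (Monogenic.ΦMap F₁ hcs₁ g) q.1.2) =
            Units.map ((F₂.map g.unop).alg : (F₂.obj A.unop).K →* (F₂.obj A'.unop).K)
              (τ A.unop q.1.1 * monoCorr F₁ F₂ c₁ c₂ hcs₁ hloc₁ τ A.unop q.1.2)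
          rw [hnat g.unop q.1.1, monoCorr_natural F₁ F₂ c₁ c₂ hcs₁ hcs₂ hloc₁ τ hnat, map_mul]
        · change MonGp.map (monoΦTransport F₁ F₂ c₁ c₂ hcs₁ hcs₂ hloc₁ hloc₂ A'.unop).toMonoidHom
              (MonGp.map (Monogenic.ΦMap F₁ hcs₁ g) q.1.2) =
            MonGp.map (Monogenic.ΦMap F₂ hcs₂ g)
              (MonGp.map (monoΦTransport F₁ F₂ c₁ c₂ hcs₁ hcs₂ hloc₁ hloc₂ A.unop).toMonoidHom q.1.2)
          rw [← MonoidHom.comp_apply, ← MonGp.map_comp, ← MonoidHom.comp_apply, ← MonGp.map_comp]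
          congr 1
          exact congrArg MonGp.map (MonoidHom.ext fun x => monoΦTransport_natural F₁ F₂ c₁ c₂ hcs₁ hcs₂ hloc₁ hloc₂ g x) }
  comm A u := rfl

/-- The `β`-component of `monoMulTransport` is `monoMulTransportβ`. [cite: MochizukiFrdII2008, Ex 1.1 (ii) p.8] -/
theorem monoMulTransport_β_app (A : Dᵒᵖ) :
    ((monoMulTransport F₁ F₂ c₁ c₂ hcs₁ hcs₂ hloc₁ hloc₂ hc he τ hτ hnat hτc).β.app A).hom =
      monoMulTransportβ F₁ F₂ c₁ c₂ hcs₁ hcs₂ hloc₁ hloc₂ τ hτ hτc A := rfl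

/-- **The `η`-components are BIJECTIVE** (no hypothesis: `η_A` is the exponent isomorphism). [cite: MochizukiFrdI2008, Cor. 5.4 p.104] -/
theorem monoMulTransportη_bijective (A : Dᵒᵖ) :
    Bijective ((monoMulTransport F₁ F₂ c₁ c₂ hcs₁ hcs₂ hloc₁ hloc₂ hc he τ hτ hnat hτc).η.app A).hom :=
  (monoΦTransport F₁ F₂ c₁ c₂ hcs₁ hcs₂ hloc₁ hloc₂ A.unop).bijective

/-! ### §4. Two-sided inverse from `τ⁻¹`, hence bijective `β`-components ([FrdI] Cor 5.4's hypothesis) -/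

variable (τ' : ∀ A : D, (F₂.obj A).Kˣ →* (F₁.obj A).Kˣ)
  (hτ' : ∀ (A : D) (x : (F₂.obj A).Kˣ),
    ValuativeRel.valuation (F₂.obj A).K (x : (F₂.obj A).K) ≤ 1 → ValuativeRel.valuation (F₁.obj A).K (τ' A x : (F₁.obj A).K) ≤ 1)
  (hτ'c : ∀ A : D,
    ValuativeRel.valuation (F₁.obj A).K ((τ' A (intNonzeroToUnits (F₂.obj A).K (c₂ A)) : (F₁.obj A).Kˣ) : (F₁.obj A).K) =
      ValuativeRel.valuation (F₁.obj A).K ((c₁ A : ↥(intNonzero (F₁.obj A).K)) : (F₁.obj A).K))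
  (hinv : ∀ (A : D) (x : (F₁.obj A).Kˣ), τ' A (τ A x) = x)

/-- `η' ∘ η = id` (generator to generator twice). [cite: MochizukiFrdII2008, Ex 1.1 (ii) p.8] -/
theorem monoΦTransport_leftInverse (A : D) (x : ↥(Submonoid.powers (Monogenic.gen F₁ c₁ A))) :
    monoΦTransport F₂ F₁ c₂ c₁ hcs₂ hcs₁ hloc₂ hloc₁ A (monoΦTransport F₁ F₂ c₁ c₂ hcs₁ hcs₂ hloc₁ hloc₂ A x) = x := by
  obtain ⟨y, n, rfl⟩ := x
  rw [monoΦTransport_pow, monoΦTransport_pow]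

omit [Fact p.Prime] in include hinv in
/-- The two correcting units cancel: `τ'_A(κ_A) · κ'_A = 1`. [cite: MochizukiFrdII2008, Ex 1.1 (ii) p.8] -/
theorem map_monoCorrUnit_mul_monoCorrUnit (A : D) :
    τ' A (monoCorrUnit F₁ F₂ c₁ c₂ τ A) * monoCorrUnit F₂ F₁ c₂ c₁ τ' A = 1 := by
  rw [monoCorrUnit, monoCorrUnit, map_mul, map_inv, hinv, mul_assoc, inv_mul_cancel_left, mul_inv_cancel]

include hinv in
/-- The `γ`-dependent unit factors of `β' ∘ β` cancel: `τ'_A(corr_A γ) · corr'_A(η_A^gp γ) = 1`. [cite: MochizukiFrdII2008, Ex 1.1 (ii) p.8] -/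
theorem map_monoCorr_mul_monoCorr (A : D) (γ : Algebra.GrothendieckGroup ↥(Submonoid.powers (Monogenic.gen F₁ c₁ A))) :
    τ' A (monoCorr F₁ F₂ c₁ c₂ hcs₁ hloc₁ τ A γ) *
        monoCorr F₂ F₁ c₂ c₁ hcs₂ hloc₂ τ' A (MonGp.map (monoΦTransport F₁ F₂ c₁ c₂ hcs₁ hcs₂ hloc₁ hloc₂ A).toMonoidHom γ) = 1 := by
  have h : ((τ' A).comp (monoCorr F₁ F₂ c₁ c₂ hcs₁ hloc₁ τ A)) *
      ((monoCorr F₂ F₁ c₂ c₁ hcs₂ hloc₂ τ' A).comp (MonGp.map (monoΦTransport F₁ F₂ c₁ c₂ hcs₁ hcs₂ hloc₁ hloc₂ A).toMonoidHom)) = 1 := by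
    refine MonGp.hom_ext fun a => ?_
    obtain ⟨y, n, rfl⟩ := a
    rw [MonoidHom.mul_apply, MonoidHom.comp_apply, MonoidHom.comp_apply, MonGp.map_of, MulEquiv.coe_toMonoidHom, monoΦTransport_pow,
      monoCorr_of_pow, monoCorr_of_pow, map_pow, ← mul_pow, map_monoCorrUnit_mul_monoCorrUnit F₁ F₂ c₁ c₂ τ τ' hinv, one_pow,
      MonoidHom.one_apply]
  rw [← MonoidHom.comp_apply (τ' A), ← MonoidHom.comp_apply (monoCorr F₂ F₁ c₂ c₁ hcs₂ hloc₂ τ' A), ← MonoidHom.mul_apply, h,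
    MonoidHom.one_apply]

include hinv in
/-- `β' ∘ β = id` on the fibre products. [cite: MochizukiFrdII2008, Ex 1.1 (ii) p.8] -/
theorem monoMulTransportβ_leftInverse (A : Dᵒᵖ) (q : ↥(Monogenic.BSub F₁ hcs₁ A)) :
    monoMulTransportβ F₂ F₁ c₂ c₁ hcs₂ hcs₁ hloc₂ hloc₁ τ' hτ' hτ'c A
        (monoMulTransportβ F₁ F₂ c₁ c₂ hcs₁ hcs₂ hloc₁ hloc₂ τ hτ hτc A q) = q := by
  have h : (monoΦTransport F₂ F₁ c₂ c₁ hcs₂ hcs₁ hloc₂ hloc₁ A.unop).toMonoidHom.comp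
      (monoΦTransport F₁ F₂ c₁ c₂ hcs₁ hcs₂ hloc₁ hloc₂ A.unop).toMonoidHom = MonoidHom.id _ :=
    MonoidHom.ext fun x => monoΦTransport_leftInverse F₁ F₂ c₁ c₂ hcs₁ hcs₂ hloc₁ hloc₂ A.unop x
  refine Subtype.ext (Prod.ext ?_ ?_)
  · rw [monoMulTransportβ_fst, monoMulTransportβ_fst, monoMulTransportβ_snd, map_mul (τ' A.unop), hinv, mul_assoc,
      map_monoCorr_mul_monoCorr F₁ F₂ c₁ c₂ hcs₁ hcs₂ hloc₁ hloc₂ τ τ' hinv, mul_one]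
  · rw [monoMulTransportβ_snd, monoMulTransportβ_snd, ← MonoidHom.comp_apply, ← MonGp.map_comp, h, MonGp.map_id,
      MonoidHom.id_apply]

variable (hinv' : ∀ (A : D) (y : (F₂.obj A).Kˣ), τ A (τ' A y) = y)

include τ' hτ' hτ'c hinv hinv' in
/-- **`β_A` is BIJECTIVE** when `τ` has a two-sided integral inverse `τ'` (same section hypothesis). [cite: MochizukiFrdI2008, Cor. 5.4 p.104] -/
theorem monoMulTransportβ_bijective (A : Dᵒᵖ) :
    Bijective (monoMulTransportβ F₁ F₂ c₁ c₂ hcs₁ hcs₂ hloc₁ hloc₂ τ hτ hτc A) :=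
  Function.bijective_iff_has_inverse.mpr ⟨monoMulTransportβ F₂ F₁ c₂ c₁ hcs₂ hcs₁ hloc₂ hloc₁ τ' hτ' hτ'c A,
    fun q => monoMulTransportβ_leftInverse F₁ F₂ c₁ c₂ hcs₁ hcs₂ hloc₁ hloc₂ τ hτ hτc τ' hτ' hτ'c hinv A q,
    fun q => monoMulTransportβ_leftInverse F₂ F₁ c₂ c₁ hcs₂ hcs₁ hloc₂ hloc₁ τ' hτ' hτ'c τ hτ hτc hinv' A q⟩

end Transport

/-! ### §5. The specialisation at the bad-place datum `C⊢_v` (`Φ = ℕ·log(q̲_v)`, [IUTchI] Ex 3.2 (iv)) -/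

section Bad

variable {D : Type u} [Category.{v} D] {p : ℕ} [Fact p.Prime] (F₁ F₂ : D ⥤ PadicFld.{u} p)
  {Kv : Type u} [Field Kv] [ValuativeRel Kv] (E₁ : RelEmb F₁ Kv) (E₂ : RelEmb F₂ Kv)
  (hloc₁ : ∀ A : D, (F₁.obj A).IsPadicLocal) (hloc₂ : ∀ A : D, (F₂.obj A).IsPadicLocal)
  (hc : IsConnected D) (he : IsTotallyEpimorphic D) {q' : intNonzero Kv} (hq' : ¬ IsUnit q')
  (τ : ∀ A : D, (F₁.obj A).Kˣ →* (F₂.obj A).Kˣ)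
  (hτ : ∀ (A : D) (x : (F₁.obj A).Kˣ),
    ValuativeRel.valuation (F₁.obj A).K (x : (F₁.obj A).K) ≤ 1 → ValuativeRel.valuation (F₂.obj A).K (τ A x : (F₂.obj A).K) ≤ 1)
  (hnat : ∀ {A A' : D} (f : A' ⟶ A) (x : (F₁.obj A).Kˣ),
    τ A' (Units.map ((F₁.map f).alg : (F₁.obj A).K →* (F₁.obj A').K) x) =
      Units.map ((F₂.map f).alg : (F₂.obj A).K →* (F₂.obj A').K) (τ A x))
  (hτq : ∀ A : D,
    ValuativeRel.valuation (F₂.obj A).K ((τ A (intNonzeroToUnits (F₁.obj A).K (E₁.img q' A)) : (F₂.obj A).Kˣ) : (F₂.obj A).K) =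
      ValuativeRel.valuation (F₂.obj A).K ((E₂.img q' A : ↥(intNonzero (F₂.obj A).K)) : (F₂.obj A).K))

/-- **The transport of the bad-place datum** `C⊢_v` of `Φ_{𝒞⊢_v} := ℕ·log_Φ(q̲_v)` ([IUTchI] Ex 3.2 (iv); abc-iut-L1-t4's `BadLocalKit.datum`,
the monogenic datum of the section `A ↦` image of `q̲_v` in `K_A`) along a natural integral multiplicative `τ` preserving the valuation of the
image of `q̲_v`: `monoMulTransport` at `c := E.img q̲` (all of §1–§4 apply verbatim, e.g. `monoMulTransportβ_bijective` for an inverse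
family). [cite: Mochizuki2012, I Ex 3.2 (iv) p.71] -/
abbrev badDatumMulTransport :
    ModelFrobenioid.DataHom (BadLocalKit.datum E₁ hloc₁ hc he hq').divB (BadLocalKit.datum E₂ hloc₂ hc he hq').divB :=
  monoMulTransport F₁ F₂ (E₁.img q') (E₂.img q') (E₁.isConstantSection hq') (E₂.isConstantSection hq') hloc₁ hloc₂ hc he τ hτ
    hnat hτq

/-- Its `β`-component carries the lift `q̲̂₁` of the section (which determines `τ⊢_v`, abc-iut-L1-t4 `BadLocalKit.tauDash`) to `q̲̂₂` ON THE
NOSE. [cite: Mochizuki2012, I Ex 3.2 (iv) p.71] -/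
theorem badDatumMulTransportβ_liftGen (A : Dᵒᵖ) :
    ((badDatumMulTransport F₁ F₂ E₁ E₂ hloc₁ hloc₂ hc he hq' τ hτ hnat hτq).β.app A).hom
        (Monogenic.liftGen F₁ (E₁.isConstantSection hq') A) = Monogenic.liftGen F₂ (E₂.isConstantSection hq') A :=
  monoMulTransportβ_liftGen F₁ F₂ (E₁.img q') (E₂.img q') (E₁.isConstantSection hq') (E₂.isConstantSection hq') hloc₁ hloc₂ τ hτ
    hτq A

end Bad

end PadicFrd

end Literature.AlgebraicGeometry.Frobenioids

end
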